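import Summits.CriticalPhenomena.PercolationContinuityZ3.Theorems.PercNearOneGluingNoHeavyLowerTailKnQuestion8CoefficientwiseCoreClassKernelMixTwoArmsCore

/-!
# Two-arm gluing for the chordless two-type inequality, III: the two-block theorem (block form)

Support file (`--supports stmt-CriticalPhenomena-4575`, closed), prover `prim-cplus-coupling` (gen 71).  No definitions, no named
facts, no sorries; standard axioms.  Memo `prim-cplus-coupling/A5-COUPLING-gen71.md` §2; setting and notation as in
`…KernelMixTwoArmsCore` (block form of the chordless two-type inequality for a two-block bouquet).

* `TwoArms.two_arms_blockForm` — **THEOREM (chordless two-type inequality for two blocks, block form)**: for two blocks satisfying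
  the single-block chorded inequality (X2₁) for all pairs of upper families, levels consistent at the corner, and fibre/row data of
  two upper families of `P × Q` with the corner/apex/column couplings, the bad sources of the chordless instance (the `Q`-arm ones
  and the `P`-arm ones with the corner removed) number at most its credits (the `Q`-column read in the top fibres, apex included; the
  `P`-row read in the top rows, apex removed; the two pools).  It is `two_arms_core` for the data or for the data with
  `(A, D) ↔ (C, B)`: the four orientation cases and their mirror images exhaust all sixteen emptiness patterns of the four bad-source
  sets.  This is the first case (`r = 2`, all cycle lengths) of the lane's chordless two-type conjecture (memo gen 70 §4/§6.4); the
  only single-block input is the chorded inequality, no matchings and no chain.  The transport to the literal product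
  `P × Q` and the instantiation with cycle words (`Bouquet.HBundle.x2`) are left to a companion file.
[cite: KozmaNitzan2024, Questions 8–9 (§5.5 p. 36) (context); Harris 1960; Kleitman 1966]
-/

namespace Summit.CriticalPhenomena.PercolationContinuityZ3.Theorems.Coefficientwise.TwoArms

open Finset

variable {P Q : Type*} [Fintype P] [DecidableEq P] [Preorder P] [Fintype Q] [DecidableEq Q] [Preorder Q]

/-- **THEOREM (chordless two-type inequality for two-block bouquets, block form).**  Two blocks `P, Q` (least/greatest
elements `b, t`, mirror involution `c` with `c b = t`, levels `D, B` avoiding `t`, lower on the `P` side) each satisfying the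
single-block two-type inequality (X2₁) for all pairs of upper families; levels consistent at the corner; fibres `A₀ ⊆ A₁`,
`C₀ ⊆ C₁` (upper families of `Q`) and rows `A⁰ ⊆ A¹`, `C⁰ ⊆ C¹` (of `P`) of two upper families `A, C` of `P × Q`, with the
corner/apex/column couplings.  Then the bad sources of the chordless instance — `Q`-arm `(A₀∖C₀)∩(D_Q∖B_Q)`, `(C₀∖A₀)∩(B_Q∖D_Q)`
and `P`-arm (corner `b_P` removed) — are at most its credits: typed and shared credits of the `Q`-column read in `(A₁, C₁)` (apex
included), of the `P`-row read in `(A¹, C¹)` (apex `t_P` removed), and the two pools read in `(A₀, C₀)`, `(A⁰, C⁰)` (corner with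
the `Q`-arm).  Memo gen 71 §2; the case analysis is `two_arms_core` applied to the data or to the data with `(A, D) ↔ (C, B)`. -/
theorem two_arms_blockForm
    (bP tP : P) (cP : P → P) (DP BP : Finset P)
    (hbP : ∀ p, bP ≤ p) (hcP : Function.Involutive cP) (hcPb : cP bP = tP)
    (hDPl : IsLowerSet (DP : Set P)) (hBPl : IsLowerSet (BP : Set P)) (hDPt : tP ∉ DP) (hBPt : tP ∉ BP)
    (hXP : ∀ A C : Finset P, IsUpperSet (A : Set P) → IsUpperSet (C : Set P) →
      ((A \ C) ∩ (DP \ BP)).card + ((C \ A) ∩ (BP \ DP)).card ≤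
        ((A \ C) ∩ univ.filter (fun x => cP x ∈ DP)).card + ((C \ A) ∩ univ.filter (fun x => cP x ∈ BP)).card +
          (A ∩ C ∩ univ.erase bP).card + (A ∩ C ∩ (univ.erase tP \ (DP ∪ BP))).card)
    (bQ tQ : Q) (cQ : Q → Q) (DQ BQ : Finset Q)
    (htQ : ∀ q, q ≤ tQ) (hbtQ : bQ ≠ tQ) (hcQ : Function.Involutive cQ) (hcQb : cQ bQ = tQ)
    (hDQt : tQ ∉ DQ) (hBQt : tQ ∉ BQ)
    (hXQ : ∀ A C : Finset Q, IsUpperSet (A : Set Q) → IsUpperSet (C : Set Q) →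
      ((A \ C) ∩ (DQ \ BQ)).card + ((C \ A) ∩ (BQ \ DQ)).card ≤
        ((A \ C) ∩ univ.filter (fun x => cQ x ∈ DQ)).card + ((C \ A) ∩ univ.filter (fun x => cQ x ∈ BQ)).card +
          (A ∩ C ∩ univ.erase bQ).card + (A ∩ C ∩ (univ.erase tQ \ (DQ ∪ BQ))).card)
    (hDc : bP ∈ DP ↔ bQ ∈ DQ) (hBc : bP ∈ BP ↔ bQ ∈ BQ)
    (AQb AQt CQb CQt : Finset Q) (APb APt CPb CPt : Finset P)
    (hAQb : IsUpperSet (AQb : Set Q)) (hCQb : IsUpperSet (CQb : Set Q))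
    (hAPb : IsUpperSet (APb : Set P)) (hCPb : IsUpperSet (CPb : Set P))
    (hAQ : AQb ⊆ AQt) (hCQ : CQb ⊆ CQt) (hAP : APb ⊆ APt) (hCP : CPb ⊆ CPt)
    (hA00 : bQ ∈ AQb ↔ bP ∈ APb) (hC00 : bQ ∈ CQb ↔ bP ∈ CPb)
    (hA11 : tQ ∈ AQt ↔ tP ∈ APt) (hC11 : tQ ∈ CQt ↔ tP ∈ CPt)
    (hAPQ : APb.Nonempty → AQt = univ) (hCPQ : CPb.Nonempty → CQt = univ)
    (hAQP : AQb.Nonempty → APt = univ) (hCQP : CQb.Nonempty → CPt = univ) :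
    ((AQb \ CQb) ∩ (DQ \ BQ)).card + ((CQb \ AQb) ∩ (BQ \ DQ)).card +
        (((APb \ CPb) ∩ (DP \ BP)).erase bP).card + (((CPb \ APb) ∩ (BP \ DP)).erase bP).card ≤
      ((AQt \ CQt) ∩ univ.filter (fun x => cQ x ∈ DQ)).card + ((CQt \ AQt) ∩ univ.filter (fun x => cQ x ∈ BQ)).card +
          (AQt ∩ CQt ∩ univ.erase bQ).card +
        ((((APt \ CPt) ∩ univ.filter (fun x => cP x ∈ DP)).erase tP).card +
          (((CPt \ APt) ∩ univ.filter (fun x => cP x ∈ BP)).erase tP).card + ((APt ∩ CPt ∩ univ.erase bP).erase tP).card) +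
        (AQb ∩ CQb ∩ (univ.erase tQ \ (DQ ∪ BQ))).card + ((APb ∩ CPb ∩ (univ.erase tP \ (DP ∪ BP))).erase bP).card := by
  -- the same data with the roles of `(A, D)` and `(C, B)` exchanged
  have hXP' : ∀ A C : Finset P, IsUpperSet (A : Set P) → IsUpperSet (C : Set P) →
      ((A \ C) ∩ (BP \ DP)).card + ((C \ A) ∩ (DP \ BP)).card ≤
        ((A \ C) ∩ univ.filter (fun x => cP x ∈ BP)).card + ((C \ A) ∩ univ.filter (fun x => cP x ∈ DP)).card +
          (A ∩ C ∩ univ.erase bP).card + (A ∩ C ∩ (univ.erase tP \ (BP ∪ DP))).card := by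
    intro A C hA hC
    have h := hXP C A hC hA
    rw [inter_comm C A, union_comm DP BP] at h
    omega
  have hXQ' : ∀ A C : Finset Q, IsUpperSet (A : Set Q) → IsUpperSet (C : Set Q) →
      ((A \ C) ∩ (BQ \ DQ)).card + ((C \ A) ∩ (DQ \ BQ)).card ≤
        ((A \ C) ∩ univ.filter (fun x => cQ x ∈ BQ)).card + ((C \ A) ∩ univ.filter (fun x => cQ x ∈ DQ)).card +
          (A ∩ C ∩ univ.erase bQ).card + (A ∩ C ∩ (univ.erase tQ \ (BQ ∪ DQ))).card := by
    intro A C hA hC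
    have h := hXQ C A hC hA
    rw [inter_comm C A, union_comm DQ BQ] at h
    omega
  rcases ((AQb \ CQb) ∩ (DQ \ BQ)).eq_empty_or_nonempty with h1V | h1V <;>
  rcases ((CQb \ AQb) ∩ (BQ \ DQ)).eq_empty_or_nonempty with h2V | h2V <;>
  rcases (((APb \ CPb) ∩ (DP \ BP)).erase bP).eq_empty_or_nonempty with h1U | h1U <;>
  rcases (((CPb \ APb) ∩ (BP \ DP)).erase bP).eq_empty_or_nonempty with h2U | h2U <;>
  first
  | exact two_arms_core bP tP cP DP BP hbP hcP hcPb hDPl hBPl hDPt hBPt hXP bQ tQ cQ DQ BQ htQ hbtQ hcQ hcQb hDQt hBQt hXQ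
      hDc hBc AQb AQt CQb CQt APb APt CPb CPt hAQb hCQb hAPb hCPb hAQ hCQ hAP hCP hA00 hA11 hC11 hAPQ hCPQ hAQP hCQP
      (Or.inl ⟨h2V, h2U⟩)
  | exact two_arms_core bP tP cP DP BP hbP hcP hcPb hDPl hBPl hDPt hBPt hXP bQ tQ cQ DQ BQ htQ hbtQ hcQ hcQb hDQt hBQt hXQ
      hDc hBc AQb AQt CQb CQt APb APt CPb CPt hAQb hCQb hAPb hCPb hAQ hCQ hAP hCP hA00 hA11 hC11 hAPQ hCPQ hAQP hCQP
      (Or.inr (Or.inl ⟨h1U, h2U⟩))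
  | exact two_arms_core bP tP cP DP BP hbP hcP hcPb hDPl hBPl hDPt hBPt hXP bQ tQ cQ DQ BQ htQ hbtQ hcQ hcQb hDQt hBQt hXQ
      hDc hBc AQb AQt CQb CQt APb APt CPb CPt hAQb hCQb hAPb hCPb hAQ hCQ hAP hCP hA00 hA11 hC11 hAPQ hCPQ hAQP hCQP
      (Or.inr (Or.inr (Or.inl ⟨h1V, h2V⟩)))
  | exact two_arms_core bP tP cP DP BP hbP hcP hcPb hDPl hBPl hDPt hBPt hXP bQ tQ cQ DQ BQ htQ hbtQ hcQ hcQb hDQt hBQt hXQ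
      hDc hBc AQb AQt CQb CQt APb APt CPb CPt hAQb hCQb hAPb hCPb hAQ hCQ hAP hCP hA00 hA11 hC11 hAPQ hCPQ hAQP hCQP
      (Or.inr (Or.inr (Or.inr ⟨h1V, h2V, h2U, h1U⟩)))
  | · have h := two_arms_core bP tP cP BP DP hbP hcP hcPb hBPl hDPl hBPt hDPt hXP' bQ tQ cQ BQ DQ htQ hbtQ hcQ hcQb hBQt hDQt
        hXQ' hBc hDc CQb CQt AQb AQt CPb CPt APb APt hCQb hAQb hCPb hAPb hCQ hAQ hCP hAP hC00 hC11 hA11 hCPQ hAPQ hCQP hAQP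
        (Or.inl ⟨h1V, h1U⟩)
      rw [inter_comm CQt AQt, inter_comm CQb AQb, inter_comm CPt APt, inter_comm CPb APb, union_comm BQ DQ, union_comm BP DP] at h
      omega
  | · have h := two_arms_core bP tP cP BP DP hbP hcP hcPb hBPl hDPl hBPt hDPt hXP' bQ tQ cQ BQ DQ htQ hbtQ hcQ hcQb hBQt hDQt
        hXQ' hBc hDc CQb CQt AQb AQt CPb CPt APb APt hCQb hAQb hCPb hAPb hCQ hAQ hCP hAP hC00 hC11 hA11 hCPQ hAPQ hCQP hAQP
        (Or.inr (Or.inr (Or.inr ⟨h2V, h1V, h1U, h2U⟩)))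
      rw [inter_comm CQt AQt, inter_comm CQb AQb, inter_comm CPt APt, inter_comm CPb APb, union_comm BQ DQ, union_comm BP DP] at h
      omega


end Summit.CriticalPhenomena.PercolationContinuityZ3.Theorems.Coefficientwise.TwoArms
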